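import Literature.Analysis.FluidPDE.PassiveVectorGalerkinModeODE
import Summits.AnomalousDissipation.AnomalousDissipation.Theorems.SolenoidalFractalHomogenisationRealisedQuasiStaticCellLawSlotWindows
import HarnessLib

/-!
# K2R `RealisedQuasiStaticCellLaw`, line `floquet-bloch`: the scalar ladder equations of the out-of-plane polarisation
# along the Galerkin solution of a cell, inside one slot (helper towards `stub_lowSectorDecay` / `stub_upperSome`;
# `--supports stmt-AnomalousDissipation-20446`)

Summits-side helper file (everything proved; no definitions, no named facts). For a lattice word `W`, `n ≥ 1`, the
Galerkin approximation of order `N` (all carrier modes resolved, `B ⊆ freqBall N`) of the cell problem in a Bloch sector,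
and a time `t ∈ [0, T]` lying in slot `j` (`r(t) = fract(t/P)·P ∈ [start j, start j + τ_j]`):

* `carrierCoeff_slot_eq_layer`: the carrier coefficient family at time `t` is literally ONE weighted Kolmogorov layer
  `l ↦ ((l = K_j ? c·a_j : 0) + (l = -K_j ? c·a'_j : 0)) • complexify ê_j`, `c = (1/n)·trap_j(r(t))`;
* `hasDerivWithinAt_inner_galerkinCoeffAt_slot`: for a direction `ζ` transversal to `k₀` and to `K_j` (out-of-plane
  polarisation of the coset `k₀ + ℤK_j`), the scalar components `u_J(t) = ⟪ζ, α_N(t)(k₀ + J•K_j)⟫` satisfy, within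
  `[0, T]` at `t`,
  `u_J' = -κ4π²|k₀ + J•K_j|² u_J - (c · 2πi (ê_j·k₀)) (a_j u_{J-1} + a'_j u_{J+1})`
  — the exact scalar three-term ladder of STUB-PLAN `stub_lowSectorDecay` §1 (out-of-plane block), in original time and
  before the gauge normalisation (`Torus.inner_pvGalerkinField_layer_coset` of `PassiveVectorLayerLadder` along the mode
  equations `PVSetup.hasDerivWithinAt_inner_galerkinCoeffAt`).
-/

set_option linter.dupNamespace false

noncomputable section

namespace Summit.AnomalousDissipation.AnomalousDissipation.Theorems.SolenoidalFractalHomogenisation.RealisedQuasiStaticCellLaw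

open Set MeasureTheory Filter Topology Function
open scoped InnerProductSpace
open Literature.Analysis Literature.Analysis.FunctionSpaces Literature.Analysis.FunctionSpaces.Torus
open Literature.Analysis.FluidPDE Literature.Analysis.FluidPDE.LatticeShear

variable {k₀ : ℕ}

/-- **Inside slot `j` the carrier coefficient family is one weighted Kolmogorov layer** (the envelope weight absorbed
into the two amplitudes). -/
theorem carrierCoeff_slot_eq_layer (W : LatticeWord k₀) {n : ℕ} (hn : 0 < n) {t : ℝ} (j : Fin k₀)
    (ht : Int.fract (t / W.period) * W.period ∈ Icc (W.start j) (W.start j + (W.phase j).τ)) :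
    (fun l => UnitAddTorus.mFourierCoeff (EuclideanSpace.complexify ∘ W.cell n t) l) =
      fun l => ((if l = (fun i => (W.phase j).m i * (n : ℤ)) then
          (((1 / (n : ℝ)) * LatticeWord.trapezoid (W.start j) (W.phase j).τ W.ramp
              (Int.fract (t / W.period) * W.period) : ℝ) : ℂ) *
            (Complex.exp ((W.phase j).φ * Complex.I) *
              (1 / (2 * ((2 * Real.pi * ‖latticeVec (W.phase j).m‖ : ℝ) : ℂ) * Complex.I))) else 0) +
        (if l = -(fun i => (W.phase j).m i * (n : ℤ)) then
          (((1 / (n : ℝ)) * LatticeWord.trapezoid (W.start j) (W.phase j).τ W.ramp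
              (Int.fract (t / W.period) * W.period) : ℝ) : ℂ) *
            (starRingEnd ℂ (Complex.exp ((W.phase j).φ * Complex.I)) *
              (-(1 / (2 * ((2 * Real.pi * ‖latticeVec (W.phase j).m‖ : ℝ) : ℂ) * Complex.I)))) else 0)) •
        EuclideanSpace.complexify (W.phase j).e := by
  funext l
  rw [mFourierCoeff_cell_slot W hn j ht l, smul_smul]
  congr 1
  simp only [mul_add, mul_ite, mul_zero]

/-- **The out-of-plane scalar ladder along the Galerkin solution, inside slot `j`.** For the Galerkin data of a cell
(`pvSetup_cell`), a truncation order `N` resolving the carrier (`⋃ⱼ{±K_j} ⊆ freqBall N`), a time `t ∈ [0, T]` in slot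
`j`, a base frequency `k₀`, a direction `ζ` transversal to `k₀` and to `K_j`, and every `J : ℤ` with
`k₀ + J•K_j ∈ freqBall N`: the component `u_J = ⟪ζ, α_N(·)(k₀ + J•K_j)⟫` satisfies within `[0, T]` at `t`
`u_J' = -κ4π²|k₀ + J•K_j|² u_J(t) - (c_j(t)·2πi(ê_j·k₀)) (a_j u_{J-1}(t) + a'_j u_{J+1}(t))`. -/
theorem hasDerivWithinAt_inner_galerkinCoeffAt_slot (W : LatticeWord k₀) {n : ℕ} (hn : 0 < n) {κ : ℝ} (hκ : 0 ≤ κ)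
    (ℓ : Fin 3 → ℤ) {w₀ : UnitAddTorus (Fin 3) → EuclideanSpace ℝ (Fin 3)}
    (hw₀ : FunctionSpaces.Torus.MemSobolev 1 (FunctionSpaces.EuclideanSpace.complexify ∘ w₀))
    (hdiv : FunctionSpaces.Torus.IsWeaklyDivFree w₀) (hmean : FunctionSpaces.Torus.HasZeroMean w₀)
    (hsupp : ∀ k : Fin 3 → ℤ, ¬ ((∃ z : Fin 3 → ℤ, k = ℓ + (n:ℤ) • z) ∨ (∃ z : Fin 3 → ℤ, k = -ℓ + (n:ℤ) • z)) →
      UnitAddTorus.mFourierCoeff (FunctionSpaces.EuclideanSpace.complexify ∘ w₀) k = 0)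
    {N : ℕ} (hBN : (Finset.univ.biUnion fun j : Fin k₀ =>
        ({(fun i => (W.phase j).m i * n), -(fun i => (W.phase j).m i * n)} : Finset (Fin 3 → ℤ))) ⊆ freqBall N)
    {T t : ℝ} (htT : t ∈ Icc 0 T) (j : Fin k₀)
    (ht : Int.fract (t / W.period) * W.period ∈ Icc (W.start j) (W.start j + (W.phase j).τ))
    (k0 : Fin 3 → ℤ) {ζ : EuclideanSpace ℂ (Fin 3)} (hζ₀ : ∑ i, (k0 i : ℂ) * ζ i = 0)
    (hζK : ∑ i, (((fun i => (W.phase j).m i * (n : ℤ)) i : ℤ) : ℂ) * ζ i = 0) (J : ℤ)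
    (hJ : k0 + J • (fun i => (W.phase j).m i * (n : ℤ)) ∈ freqBall N) :
    HasDerivWithinAt
      (fun τ => inner ℂ ζ ((pvSetup_cell W hn hκ ℓ hw₀ hdiv hmean hsupp).galerkinCoeffAt N τ
        (k0 + J • (fun i => (W.phase j).m i * (n : ℤ)))))
      (-((((κ * (4 * Real.pi ^ 2 * freqNormSq (k0 + J • (fun i => (W.phase j).m i * (n : ℤ))))) : ℝ) : ℂ) *
          inner ℂ ζ ((pvSetup_cell W hn hκ ℓ hw₀ hdiv hmean hsupp).galerkinCoeffAt N t
            (k0 + J • (fun i => (W.phase j).m i * (n : ℤ))))) -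
        (2 * Real.pi * Complex.I * ∑ i, (EuclideanSpace.complexify (W.phase j).e) i * (k0 i : ℂ)) *
          ((((1 / (n : ℝ)) * LatticeWord.trapezoid (W.start j) (W.phase j).τ W.ramp
                (Int.fract (t / W.period) * W.period) : ℝ) : ℂ) *
              (Complex.exp ((W.phase j).φ * Complex.I) *
                (1 / (2 * ((2 * Real.pi * ‖latticeVec (W.phase j).m‖ : ℝ) : ℂ) * Complex.I))) *
              inner ℂ ζ ((pvSetup_cell W hn hκ ℓ hw₀ hdiv hmean hsupp).galerkinCoeffAt N t
                (k0 + (J - 1) • (fun i => (W.phase j).m i * (n : ℤ)))) +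
            (((1 / (n : ℝ)) * LatticeWord.trapezoid (W.start j) (W.phase j).τ W.ramp
                (Int.fract (t / W.period) * W.period) : ℝ) : ℂ) *
              (starRingEnd ℂ (Complex.exp ((W.phase j).φ * Complex.I)) *
                (-(1 / (2 * ((2 * Real.pi * ‖latticeVec (W.phase j).m‖ : ℝ) : ℂ) * Complex.I)))) *
              inner ℂ ζ ((pvSetup_cell W hn hκ ℓ hw₀ hdiv hmean hsupp).galerkinCoeffAt N t
                (k0 + (J + 1) • (fun i => (W.phase j).m i * (n : ℤ))))))
      (Icc 0 T) t := by
  classical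
  set hPV := pvSetup_cell W hn hκ ℓ hw₀ hdiv hmean hsupp with hPVdef
  have h1 := hPV.hasDerivWithinAt_inner_galerkinCoeffAt hBN hJ htT ζ
  refine h1.congr_deriv ?_
  rw [carrierCoeff_slot_eq_layer W hn j ht]
  have hK0 : (fun i => (W.phase j).m i * (n : ℤ)) ≠ 0 := cellFreq_ne_zero (W.phase j) hn
  have hKS : (fun i => (W.phase j).m i * (n : ℤ)) ∈ freqBall N :=
    hBN (Finset.mem_biUnion.2 ⟨j, Finset.mem_univ _, Finset.mem_insert_self _ _⟩)
  have hKS' : -(fun i => (W.phase j).m i * (n : ℤ)) ∈ freqBall N :=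
    hBN (Finset.mem_biUnion.2 ⟨j, Finset.mem_univ _, Finset.mem_insert_of_mem (Finset.mem_singleton_self _)⟩)
  have he : ∑ i, (((fun i => (W.phase j).m i * (n : ℤ)) i : ℤ) : ℂ) * (EuclideanSpace.complexify (W.phase j).e) i = 0 :=
    sum_cellFreq_mul_complexify_e (W.phase j) n
  have hc : ∀ m, m ∉ freqBall N → hPV.galerkinCoeffAt N t m = 0 := fun m hm => by
    rw [Torus.PVSetup.galerkinCoeffAt, coeffExt_of_not_mem _ hm]
  exact Torus.inner_pvGalerkinField_layer_coset κ hK0 hKS hKS' he _ _ hc hζ₀ hζK J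

end Summit.AnomalousDissipation.AnomalousDissipation.Theorems.SolenoidalFractalHomogenisation.RealisedQuasiStaticCellLaw

end
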